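import Literature.Probability.Percolation.HalfSpace
import Literature.Probability.Percolation.MeanFieldBetaFromGamma
import Literature.Probability.Percolation.SubgraphMonotonicity
import Literature.Probability.Percolation.ConstrainedClusters
import Literature.Probability.Percolation.SharpnessDCTProofs
import Literature.Probability.Percolation.BondPercolationSymmetry
import Literature.Probability.Percolation.SiteConnectionTools
import HarnessLib

/-!
# `stub_mirrorSymm` — the two mirror half-space volume events have the half-space tail probability

Crux `Summit.CriticalPhenomena.PercolationContinuityZ3.Theses.PercLowPointHalfSpace.QuantitativeBGN`
(item stmt-CriticalPhenomena-0913), line `mirror-akn-two-arm-import`, stub `stub_mirrorSymm`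
(STUB 1 of the line's skeleton).

Statement proved (for every `p ∈ [0,1]` and every `n : ℕ`):

* `P^{ℤ³}_p(n ≤ |C_{H⁺}(e₀)|) = P^H_p(|C_H(o)| ≥ n)` for the upper half-space `H⁺ = {x | 1 ≤ x 0}`
  rooted at `e₀ = Pi.single 0 1`, and
* `P^{ℤ³}_p(n ≤ |C_{H⁻}(0)|) = P^H_p(|C_H(o)| ≥ n)` for the lower half-space `H⁻ = {x | x 0 ≤ 0}`
  rooted at `0`,

where `C_R(x) = openClusterIn (withinGraph (zdGraph 3) R) ω x` is the open cluster of `x` using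
only lattice steps inside `R`, the left sides are bond percolation on `ℤ³`
(`bondPercolation (zdGraph 3) p`) and the right side is bond percolation on the INDUCED half-space
graph `halfSpaceGraph 3 = (zdGraph 3).induce (halfSpace 3)`, `halfSpace 3 = {x | 0 ≤ x 0}`, with
its own Bernoulli measure, `clusterSizeGe x n = {ω | n ≤ |C(x)|}`.

Proof.
* Lattice symmetries (`real_clusterVolume_relabel_iso`): a graph isomorphism `φ` carrying the
  region `R` onto `R'` carries `withinGraph G R` onto `withinGraph G' R'`, hence
  (`openClusterIn_relabel`) the constrained cluster of `x` onto that of `φ x`, preserving its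
  cardinality (`Function.Injective.encard_image`); and `P_p` is invariant under `φ`
  (`bondPercolation_real_preimage_relabel_iso`). Applied to the translation `zdShiftIso e₀`
  (`{0 ≤ x 0} → {1 ≤ x 0}`, `0 ↦ e₀`) and to the reflection
  `zdSignedPermIso (Equiv.refl _) (update 1 0 (-1))` (`x 0 ↦ -x 0`, `{0 ≤ x 0} → {x 0 ≤ 0}`,
  `0 ↦ 0`), both events reduce to the standard half-space `{0 ≤ x 0}` rooted at `0`.
* Restriction coupling (`real_clusterVolume_halfSpace_eq_induced`): the push-forward of `P^{ℤ³}_p`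
  under `restrictConfig Subtype.val` is `P^H_p` (`bondPercolation_map_comap`,
  `map_measureReal_apply`), and for configurations on lattice edges (`P_p`-a.s.,
  `DCT16.real_congr_of_forall_subset_edgeSet`) the open cluster of the origin of the induced graph
  in the restricted configuration is, as a set of sites, the constrained cluster
  (`image_openCluster_restrictConfig`), of the same cardinality (`Subtype.val` injective).
-/

noncomputable section

namespace Summit.CriticalPhenomena.PercolationContinuityZ3.Theorems

open MeasureTheory Literature.Probability.Percolation Literature.Probability.LatticeModels

namespace MirrorSymm

/-- **Isomorphism invariance of constrained-cluster volume events.** If the graph isomorphism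
`φ : G ≃g G'` carries the region `R` onto `R'` (`φ x ∈ R' ↔ x ∈ R`), then the `P^{G'}_p`-probability
that the cluster of `φ x` using steps of `G'` inside `R'` has at least `n` vertices equals the
`P^G_p`-probability that the cluster of `x` using steps of `G` inside `R` has at least `n`
vertices. -/
theorem real_clusterVolume_relabel_iso {V V' : Type*} {G : SimpleGraph V} {G' : SimpleGraph V'}
    (φ : G ≃g G') {R : Set V} {R' : Set V'} (hR : ∀ x, φ x ∈ R' ↔ x ∈ R) (x : V)
    (p : unitInterval) (n : ℕ) :
    (bondPercolation G' p).real
        {ω | (n : ℕ∞) ≤ (openClusterIn (withinGraph G' R') ω (φ x)).encard} =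
      (bondPercolation G p).real
        {ω | (n : ℕ∞) ≤ (openClusterIn (withinGraph G R) ω x).encard} := by
  have hK : ∀ u v, (withinGraph G' R').Adj (φ.toEquiv u) (φ.toEquiv v) ↔
      (withinGraph G R).Adj u v := fun u v => by
    simp only [withinGraph_adj, RelIso.coe_fn_toEquiv, SimpleGraph.Iso.map_adj_iff, hR]
  have hset : BondConfig.relabel (sym2Equiv φ.toEquiv) ⁻¹'
        {ω | (n : ℕ∞) ≤ (openClusterIn (withinGraph G' R') ω (φ x)).encard} =
      {ω | (n : ℕ∞) ≤ (openClusterIn (withinGraph G R) ω x).encard} := by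
    ext ω
    have h := openClusterIn_relabel φ.toEquiv hK ω x
    rw [RelIso.coe_fn_toEquiv] at h
    simp only [Set.mem_preimage, Set.mem_setOf_eq, h, φ.injective.encard_image]
  rw [← hset, bondPercolation_real_preimage_relabel_iso φ p]

/-- **Ambient ↔ induced.** The `P^{ℤ^d}_p`-probability that the cluster of the origin using
lattice steps inside the half-space `{0 ≤ x 0}` has at least `n` vertices equals the
`P^H_p`-probability, for bond percolation on the induced half-space graph, that the open cluster of
its origin has at least `n` vertices (restriction coupling `bondPercolation_map_comap` and the
almost sure identification `image_openCluster_restrictConfig`). -/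
theorem real_clusterVolume_halfSpace_eq_induced (d : ℕ) [NeZero d] (p : unitInterval) (n : ℕ) :
    (bondPercolation (zdGraph d) p).real
        {ω | (n : ℕ∞) ≤ (openClusterIn (withinGraph (zdGraph d) (halfSpace d)) ω 0).encard} =
      (bondPercolation (halfSpaceGraph d) p).real (clusterSizeGe (halfSpaceOrigin d) n) := by
  have hmap : (bondPercolation (zdGraph d) p).map
      (restrictConfig (Subtype.val : halfSpace d → Site d)) = bondPercolation (halfSpaceGraph d) p :=
    bondPercolation_map_comap (zdGraph d) Subtype.val_injective p
  rw [← hmap, map_measureReal_apply (measurable_restrictConfig _) (measurableSet_clusterSizeGe _ _)]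
  refine DCT16.real_congr_of_forall_subset_edgeSet (zdGraph d) p fun ω hω => ?_
  rw [Set.mem_setOf_eq, Set.mem_preimage, mem_clusterSizeGe,
    ← image_openCluster_restrictConfig (zdGraph d) (halfSpace d) hω (zero_mem_halfSpace d),
    Subtype.val_injective.encard_image]
  rfl

/-- **Upper mirror copy.** Translation by `e₀ = Pi.single 0 1` (`zdShiftIso`) carries the standard
half-space `{0 ≤ x 0}` rooted at `0` onto the upper half-space `{1 ≤ x 0}` rooted at `e₀`, so the
two constrained-cluster volume events have the same `P_p`-probability. -/
theorem real_clusterVolume_upper (p : unitInterval) (n : ℕ) :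
    (bondPercolation (zdGraph 3) p).real
        {ω | (n : ℕ∞) ≤ (openClusterIn (withinGraph (zdGraph 3) {x : Site 3 | 1 ≤ x 0}) ω
          (Pi.single 0 1)).encard} =
      (bondPercolation (zdGraph 3) p).real
        {ω | (n : ℕ∞) ≤ (openClusterIn (withinGraph (zdGraph 3) (halfSpace 3)) ω 0).encard} := by
  have hR : ∀ x : Site 3, zdShiftIso (d := 3) (Pi.single 0 1) x ∈ {x : Site 3 | 1 ≤ x 0} ↔
      x ∈ halfSpace 3 := fun x => by
    simp only [zdShiftIso_apply, Set.mem_setOf_eq, Pi.add_apply, Pi.single_eq_same, halfSpace,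
      le_add_iff_nonneg_left]
  have h := real_clusterVolume_relabel_iso (zdShiftIso (d := 3) (Pi.single 0 1)) hR 0 p n
  rwa [zdShiftIso_apply, zero_add] at h

/-- **Lower mirror copy.** The reflection `x 0 ↦ -x 0` (`zdSignedPermIso` with trivial permutation
and sign `-1` on the first axis) carries the standard half-space `{0 ≤ x 0}` rooted at `0` onto the
lower half-space `{x 0 ≤ 0}` rooted at `0`, so the two constrained-cluster volume events have the
same `P_p`-probability. -/
theorem real_clusterVolume_lower (p : unitInterval) (n : ℕ) :
    (bondPercolation (zdGraph 3) p).real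
        {ω | (n : ℕ∞) ≤ (openClusterIn (withinGraph (zdGraph 3) {x : Site 3 | x 0 ≤ 0}) ω 0).encard} =
      (bondPercolation (zdGraph 3) p).real
        {ω | (n : ℕ∞) ≤ (openClusterIn (withinGraph (zdGraph 3) (halfSpace 3)) ω 0).encard} := by
  have hR : ∀ x : Site 3,
      zdSignedPermIso (d := 3) (Equiv.refl _) (Function.update 1 0 (-1)) x ∈ {x : Site 3 | x 0 ≤ 0} ↔
        x ∈ halfSpace 3 := fun x => by
    simp only [zdSignedPermIso_apply, Set.mem_setOf_eq, Site.signedPerm_apply,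
      Function.update_self, Equiv.refl_symm, Equiv.refl_apply, Units.val_neg, Units.val_one,
      neg_mul, one_mul, neg_nonpos, halfSpace]
  have h := real_clusterVolume_relabel_iso
    (zdSignedPermIso (d := 3) (Equiv.refl _) (Function.update 1 0 (-1))) hR 0 p n
  rwa [zdSignedPermIso_apply, Site.signedPerm_zero] at h

end MirrorSymm

open MirrorSymm in
/-- **STUB 1 of line `mirror-akn-two-arm-import` (`MirrorSymm`).** For every `p` and `n`: the
upper half-space volume event `{n ≤ |C_{H⁺}(e₀)|}` (`H⁺ = {1 ≤ x 0}`, `e₀ = Pi.single 0 1`) and the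
lower half-space volume event `{n ≤ |C_{H⁻}(0)|}` (`H⁻ = {x 0 ≤ 0}`) of bond percolation on `ℤ³`
both have `P^{ℤ³}_p`-probability EQUAL to the `P^H_p`-probability that the open cluster of the
origin of the induced half-space graph `halfSpaceGraph 3` has at least `n` vertices: lattice
symmetries (`real_clusterVolume_upper`, `real_clusterVolume_lower`) followed by the restriction
coupling ambient ↔ induced (`real_clusterVolume_halfSpace_eq_induced`). -/
theorem stub_mirrorSymm :
    ∀ (p : unitInterval) (n : ℕ),
      (bondPercolation (zdGraph 3) p).real
          {ω | (n : ℕ∞) ≤ (openClusterIn (withinGraph (zdGraph 3) {x : Site 3 | 1 ≤ x 0}) ω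
            (Pi.single 0 1)).encard} =
        (bondPercolation (halfSpaceGraph 3) p).real (clusterSizeGe (halfSpaceOrigin 3) n) ∧
      (bondPercolation (zdGraph 3) p).real
          {ω | (n : ℕ∞) ≤ (openClusterIn (withinGraph (zdGraph 3) {x : Site 3 | x 0 ≤ 0}) ω 0).encard} =
        (bondPercolation (halfSpaceGraph 3) p).real (clusterSizeGe (halfSpaceOrigin 3) n) := by
  intro p n
  exact ⟨(real_clusterVolume_upper p n).trans (real_clusterVolume_halfSpace_eq_induced 3 p n),
    (real_clusterVolume_lower p n).trans (real_clusterVolume_halfSpace_eq_induced 3 p n)⟩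

end Summit.CriticalPhenomena.PercolationContinuityZ3.Theorems

end
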